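import Summits.QuantumFields.YangMills.Theorems.LangevinControlUVOSLegsFromFemtoAndGapDefsR3
import Summits.QuantumFields.YangMills.Theorems.LangevinControlUVOSLegsFromFemtoAndGapStubAssemblyRPPositivity
import Summits.QuantumFields.YangMills.Theorems.PencilRigidityNPointIsotropyUnorderedRPTransport
import Summits.QuantumFields.YangMills.Theorems.LangevinControlUVOSLegsAtWeakCouplingCStubRopeCutoff
import HarnessLib

/-!
# Stub `stub_rope` of line `Sketch` (crux `OSLegsAtWeakCouplingC`, stmt-QuantumFields-16207) — helper II:
# `RPPos` of the soft limit

Helper file for stub `stub_rope` (DefsR3 §4.4 `Statement.stub_rope`): its reflection-positivity half.  Along any soft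
bundle (DefsR3 `SoftBundle`) the one-field limit `S₁` is reflection positive on finite tuples of OFF-DIAGONAL test
functions supported at POSITIVE times (`RPPos`, not necessarily time-ordered).  This is toolkit XXI
(`rp_nonneg_of_compactTime`, `isReflectionPositive_of_softLimit`) with the time-ordering hypothesis replaced by
positive-time + off-diagonal: the lattice square only needs positive half-space support (`rpSquare_fieldObs_nonneg`),
the witnesses `ΘFᵢ* ⊗ Fⱼ` of such tuples are still in `⁰𝒮` (`isOffDiagonal_osAdjoint_appendTensor`: a coincidence
inside one block is a coincidence of that block, across the blocks it is off the support), and the density step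
uses compact cutoffs that stay in `⁰𝒮` (helper I, `exists_offDiagonal_cutoff_tendsto'`).
* `rp_nonneg_of_compactTime_pos`, `rpPos_of_softLimit` — the two steps;
* `rpPos_of_softBundle` — the export read off a `SoftBundle` (any demands `b₀`, `g`).
-/

noncomputable section

open scoped SchwartzMap BigOperators ComplexConjugate
open MeasureTheory Filter Topology
open Literature.MathematicalPhysics.QuantumFieldTheory Literature.MathematicalPhysics.QuantumLattice
open Literature.MathematicalPhysics.AQFT
open Literature.Probability.LatticeModels (box Site)
open Summit.QuantumFields.YangMills.Cruxes.OSLegsFromFemtoAndGap.DlrCollarTransfer (SoftBundle RPPos)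
open Summit.QuantumFields.YangMills.Theorems.NPointIsotropy.QuarterTurnCornerOperator.UnorderedRP
  (isOffDiagonal_osAdjoint_appendTensor)

namespace Summit.QuantumFields.YangMills.Theorems.OSLegsFromFemtoAndGap

variable {G : Type} [Group G] [TopologicalSpace G] [IsTopologicalGroup G] [CompactSpace G]
  [MeasurableSpace G] [BorelSpace G]

/-! ### E2 on compactly supported positive-time off-diagonal tuples -/

-- adapted from toolkit XXI `rp_nonneg_of_compactTime` (time-ordered ↦ positive-time + off-diagonal)
/-- **Reflection positivity of the soft limit on compactly-time-supported positive-time off-diagonal tuples.** -/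
theorem rp_nonneg_of_compactTime_pos (r : LatticeRep G) {βk : ℕ → ℝ} {Lk : ℕ → ℕ} {ak : ℕ → ℝ} {K : ℝ} (hK : 0 ≤ K)
    (hβ : ∀ k, 0 ≤ βk k) (hL : ∀ k, 1 ≤ Lk k) (ha : ∀ k, 0 < ak k) (ha0 : Tendsto ak atTop (𝓝 0))
    (haL : Tendsto (fun k => ak k * Lk k) atTop atTop) (S₁ : SchwingerFamily (EuclideanSpace ℝ (Fin 4)))
    (hlim : ∀ (m : ℕ) (F : 𝓢((Fin m → (EuclideanSpace ℝ (Fin 4))), ℂ)), (2 ≤ m → IsOffDiagonal F) →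
      Tendsto (fun k => latticeDist r.ρ (βk k) (Lk k) (ak k) r.curvature.F
        (wilsonTorusMean r.ρ (βk k) (Lk k) r.curvature.F) m F) atTop (𝓝 (S₁ m F)))
    (hdef : ∀ (k m : ℕ), 2 ≤ m → ∀ rr : Fin m → Fin 4 × Fin 4, (∀ i, (rr i).1 < (rr i).2) →
      ∀ F : 𝓢((Fin m → (EuclideanSpace ℝ (Fin 4))), ℂ), IsOffDiagonal F → ∀ c : Fin m → (EuclideanSpace ℝ (Fin 4)), (∀ l, ‖c l‖ ≤ ak k) →
        ‖∑ z ∈ Fintype.piFinset (fun _ : Fin m => box 4 (Lk k)),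
            ((torusMomentStr r.ρ (βk k) (Lk k) (fun i U => plaquetteObs r.ρ 0 (rr i).1 (rr i).2 U)
              (fun i => wilsonTorusMean r.ρ (βk k) (Lk k) (fun U => plaquetteObs r.ρ 0 (rr i).1 (rr i).2 U)) z : ℝ) : ℂ) *
            (F ((fun l => ak k • siteToE (z l)) + c) - F (fun l => ak k • siteToE (z l)))‖ ≤
          2 * ‖c‖ * K ^ m * (SchwartzMap.seminorm ℂ 0 (4 * m + 1) F + SchwartzMap.seminorm ℂ (6 * m) (4 * m + 1) F +
            SchwartzMap.seminorm ℂ 0 1 F + SchwartzMap.seminorm ℂ (6 * m) 1 F + SchwartzMap.seminorm ℂ (10 * m) 1 F))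
    {N : ℕ} {deg : Fin N → ℕ} (F : (j : Fin N) → 𝓢((Fin (deg j) → (EuclideanSpace ℝ (Fin 4))), ℂ))
    (hF : ∀ j, IsPositiveTimeMulti (F j)) (hFo : ∀ j, IsOffDiagonal (F j))
    {T : ℝ} (hT : ∀ j (u : Fin (deg j) → (EuclideanSpace ℝ (Fin 4))), (∃ l, u l 0 ≤ 0 ∨ T < u l 0) → F j u = 0)
    (H : (i j : Fin N) → 𝓢((Fin (deg i + deg j) → (EuclideanSpace ℝ (Fin 4))), ℂ))
    (hH : ∀ i j, IsAppendTensorOf (H i j) (osAdjoint (F i)) (F j)) :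
    let z := ∑ i, ∑ j, S₁ (deg i + deg j) (H i j)
    0 ≤ z.re ∧ z.im = 0 := by
  classical
  intro z
  -- off-diagonality of the witnesses
  have hHoff : ∀ i j, IsOffDiagonal (H i j) := fun i j => by
    have hHeq : H i j = (osAdjoint (F i)).appendTensor (F j) := by
      ext x; rw [hH i j x, SchwartzMap.appendTensor_apply]
    rw [hHeq]
    exact isOffDiagonal_osAdjoint_appendTensor (hF i) (hFo i) (hF j) (hFo j)
  -- the lattice OS forms and their limit
  set zk : ℕ → ℂ := fun k => ∑ i, ∑ j, latticeDist r.ρ (βk k) (Lk k) (ak k) r.curvature.F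
    (wilsonTorusMean r.ρ (βk k) (Lk k) r.curvature.F) (deg i + deg j) (H i j) with hzk
  have hz : Tendsto zk atTop (𝓝 z) :=
    tendsto_finsetSum _ fun i _ => tendsto_finsetSum _ fun j _ => hlim _ _ fun _ => hHoff i j
  -- the reflection-positivity squares
  set mk : ℕ → Fin 4 × Fin 4 → ℝ := fun k pl =>
    wilsonTorusMean r.ρ (βk k) (Lk k) (fun U => plaquetteObs r.ρ 0 pl.1 pl.2 U) with hmk
  set pk : ℕ → ℂ := fun k => wilsonExpectation (d := 4) (L := 2 * Lk k + 1) r.ρ (βk k) fun U =>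
    conj (∑ j, fieldObs r (Lk k) (ak k) (F j) (mk k) U.timeReflect) * ∑ j, fieldObs r (Lk k) (ak k) (F j) (mk k) U
    with hpk
  have hFvan : ∀ k j (y : Fin (deg j) → Site 4), (∃ l, y l 0 ≤ 0) → F j (fun l => ak k • siteToE (y l)) = 0 :=
    fun k j y ⟨l, hl⟩ => apply_eq_zero_of_time (ha k) (F j) (hT j) y ⟨l, Or.inl hl⟩
  have hp : ∀ᶠ k in atTop, 0 ≤ (pk k).re ∧ (pk k).im = 0 :=
    Eventually.of_forall fun k => rpSquare_fieldObs_nonneg r (hL k) (hβ k) (ak k) F (hFvan k) (mk k)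
  -- P: the square as the shifted sum, for `T < aₖ Lₖ`
  set Pk : ℕ → Fin N → Fin N → ℂ := fun k i j =>
    ∑ q ∈ Fintype.piFinset (fun _ : Fin (deg i) => Finset.univ.filter fun pl : Fin 4 × Fin 4 => pl.1 < pl.2),
      ∑ p ∈ Fintype.piFinset (fun _ : Fin (deg j) => Finset.univ.filter fun pl : Fin 4 × Fin 4 => pl.1 < pl.2),
      ∑ x ∈ Fintype.piFinset (fun _ : Fin (deg i) => box 4 (Lk k)),
      ∑ y ∈ Fintype.piFinset (fun _ : Fin (deg j) => box 4 (Lk k)),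
        conj (F i (fun l => timeReflection 4 (ak k • siteToE (x (Fin.rev l))) +
            (ak k * (1 - if (q (Fin.rev l)).1 = 0 then 1 else 0)) • siteToE (Pi.single (0 : Fin 4) (1 : ℤ)))) *
          F j (fun l => ak k • siteToE (y l)) *
          (torusMomentStr r.ρ (βk k) (Lk k)
            (fun l U => plaquetteObs r.ρ 0 (Fin.append q p l).1 (Fin.append q p l).2 U)
            (Fin.append (fun l => wilsonTorusMean r.ρ (βk k) (Lk k) (fun U => plaquetteObs r.ρ 0 (q l).1 (q l).2 U))
              (fun l => wilsonTorusMean r.ρ (βk k) (Lk k) (fun U => plaquetteObs r.ρ 0 (p l).1 (p l).2 U)))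
            (Fin.append x y) : ℂ) with hPk
  have hpk_eq : ∀ᶠ k in atTop, pk k = ∑ i, ∑ j, Pk k i j := by
    filter_upwards [haL.eventually_gt_atTop T] with k hk
    rw [hpk]
    dsimp only
    rw [wilsonExpectation_rpSquare_eq]
    refine Finset.sum_congr rfl fun i _ => Finset.sum_congr rfl fun j _ => ?_
    rw [rpTerm_eq_shifted r (βk k) (Lk k) (ha k) hk (F i) (hT i) (F j) (mk k)]
  -- Z − P = O(aₖ), pair by pair
  set Sp : Fin N → Fin N → ℝ := fun i j => SchwartzMap.seminorm ℂ 0 (4 * (deg i + deg j) + 1) (H i j) +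
    SchwartzMap.seminorm ℂ (6 * (deg i + deg j)) (4 * (deg i + deg j) + 1) (H i j) + SchwartzMap.seminorm ℂ 0 1 (H i j) +
    SchwartzMap.seminorm ℂ (6 * (deg i + deg j)) 1 (H i j) + SchwartzMap.seminorm ℂ (10 * (deg i + deg j)) 1 (H i j) with hSp
  set C : ℝ := ∑ i, ∑ j, 6 ^ deg i * 6 ^ deg j * (2 * K ^ (deg i + deg j) * Sp i j) with hC
  have hpair : ∀ k i j, ‖latticeDist r.ρ (βk k) (Lk k) (ak k) r.curvature.F
      (wilsonTorusMean r.ρ (βk k) (Lk k) r.curvature.F) (deg i + deg j) (H i j) - Pk k i j‖ ≤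
      6 ^ deg i * 6 ^ deg j * (2 * ak k * K ^ (deg i + deg j) * Sp i j) := by
    intro k i j
    refine norm_rpDefect_le r (βk k) (Lk k) (ha k).le hK (F i) (F j) (H i j) (hH i j) fun rr hrr c hc => ?_
    rcases Nat.lt_or_ge (deg i + deg j) 2 with h2 | h2
    · rw [defectSum_eq_zero_of_le_one r (βk k) (Lk k) (ak k) (by omega) rr (H i j) c, norm_zero]
      have : 0 ≤ Sp i j := by rw [hSp]; positivity
      positivity
    · exact hdef k _ h2 rr hrr (H i j) (hHoff i j) c hc
  have hnear : ∀ᶠ k in atTop, ‖zk k - pk k‖ ≤ ak k * C := by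
    filter_upwards [hpk_eq] with k hk
    rw [hk, hzk]
    dsimp only
    rw [← Finset.sum_sub_distrib]
    simp_rw [← Finset.sum_sub_distrib]
    calc _ ≤ ∑ i, ‖∑ j, (latticeDist r.ρ (βk k) (Lk k) (ak k) r.curvature.F
          (wilsonTorusMean r.ρ (βk k) (Lk k) r.curvature.F) (deg i + deg j) (H i j) - Pk k i j)‖ := norm_sum_le _ _
      _ ≤ ∑ i, ∑ j, 6 ^ deg i * 6 ^ deg j * (2 * ak k * K ^ (deg i + deg j) * Sp i j) :=
          Finset.sum_le_sum fun i _ => (norm_sum_le _ _).trans (Finset.sum_le_sum fun j _ => hpair k i j)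
      _ = ak k * C := by
          rw [hC, Finset.mul_sum]
          refine Finset.sum_congr rfl fun i _ => ?_
          rw [Finset.mul_sum]
          exact Finset.sum_congr rfl fun j _ => by ring
  have hε : Tendsto (fun k => ak k * C) atTop (𝓝 0) := by simpa using ha0.mul_const C
  exact nonneg_of_tendsto_of_near hz hp hε hnear

/-! ### `RPPos` by density -/

/-- Cutting off a positive-time test function inside its support and the ball of radius `R` keeps it positive-time
and gives it compact time support in `(0, R]`. -/
theorem cutoff_props_pos {m : ℕ} {F u : 𝓢((Fin m → (EuclideanSpace ℝ (Fin 4))), ℂ)} (hF : IsPositiveTimeMulti F) {R : ℝ}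
    (hu : tsupport (u : (Fin m → (EuclideanSpace ℝ (Fin 4))) → ℂ) ⊆ tsupport (F : (Fin m → (EuclideanSpace ℝ (Fin 4))) → ℂ) ∩ Metric.closedBall 0 R) :
    IsPositiveTimeMulti u ∧ ∀ x : Fin m → (EuclideanSpace ℝ (Fin 4)), (∃ l, x l 0 ≤ 0 ∨ R < x l 0) → u x = 0 := by
  refine ⟨(hu.trans Set.inter_subset_left).trans hF, fun x hx => ?_⟩
  by_contra hne
  have hmem : x ∈ tsupport (u : (Fin m → (EuclideanSpace ℝ (Fin 4))) → ℂ) := subset_tsupport _ hne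
  obtain ⟨l, hl | hl⟩ := hx
  · exact absurd (hF (hu hmem).1 l) (not_lt.2 hl)
  · have h1 : ‖x‖ ≤ R := mem_closedBall_zero_iff.1 (hu hmem).2
    have h2 : x l 0 ≤ ‖x‖ :=
      ((le_abs_self _).trans (by simpa using PiLp.norm_apply_le (x l) 0)).trans (norm_le_pi_norm x l)
    linarith

-- adapted from toolkit XXI `isReflectionPositive_of_softLimit`
/-- **`RPPos` of the soft limit**: E2 on finite tuples of positive-time off-diagonal test functions. -/
theorem rpPos_of_softLimit (r : LatticeRep G) {βk : ℕ → ℝ} {Lk : ℕ → ℕ} {ak : ℕ → ℝ} {K : ℝ}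
    (hK : 0 ≤ K) (hβ : ∀ k, 0 ≤ βk k) (hL : ∀ k, 1 ≤ Lk k) (ha : ∀ k, 0 < ak k) (ha0 : Tendsto ak atTop (𝓝 0))
    (haL : Tendsto (fun k => ak k * Lk k) atTop atTop) (S₁ : SchwingerFamily (EuclideanSpace ℝ (Fin 4)))
    (hlim : ∀ (m : ℕ) (F : 𝓢((Fin m → (EuclideanSpace ℝ (Fin 4))), ℂ)), (2 ≤ m → IsOffDiagonal F) →
      Tendsto (fun k => latticeDist r.ρ (βk k) (Lk k) (ak k) r.curvature.F
        (wilsonTorusMean r.ρ (βk k) (Lk k) r.curvature.F) m F) atTop (𝓝 (S₁ m F)))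
    (hdef : ∀ (k m : ℕ), 2 ≤ m → ∀ rr : Fin m → Fin 4 × Fin 4, (∀ i, (rr i).1 < (rr i).2) →
      ∀ F : 𝓢((Fin m → (EuclideanSpace ℝ (Fin 4))), ℂ), IsOffDiagonal F → ∀ c : Fin m → (EuclideanSpace ℝ (Fin 4)), (∀ l, ‖c l‖ ≤ ak k) →
        ‖∑ z ∈ Fintype.piFinset (fun _ : Fin m => box 4 (Lk k)),
            ((torusMomentStr r.ρ (βk k) (Lk k) (fun i U => plaquetteObs r.ρ 0 (rr i).1 (rr i).2 U)
              (fun i => wilsonTorusMean r.ρ (βk k) (Lk k) (fun U => plaquetteObs r.ρ 0 (rr i).1 (rr i).2 U)) z : ℝ) : ℂ) *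
            (F ((fun l => ak k • siteToE (z l)) + c) - F (fun l => ak k • siteToE (z l)))‖ ≤
          2 * ‖c‖ * K ^ m * (SchwartzMap.seminorm ℂ 0 (4 * m + 1) F + SchwartzMap.seminorm ℂ (6 * m) (4 * m + 1) F +
            SchwartzMap.seminorm ℂ 0 1 F + SchwartzMap.seminorm ℂ (6 * m) 1 F + SchwartzMap.seminorm ℂ (10 * m) 1 F)) :
    RPPos S₁ := by
  classical
  intro N deg F hF hFo H hH
  -- off-diagonal compact cutoffs
  choose u hu_supp hu_off hu_lim using fun j => exists_offDiagonal_cutoff_tendsto' (F j) (hFo j)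
  -- the approximating OS forms are non-negative
  have hstep : ∀ m : ℕ, let zm := ∑ i, ∑ j, S₁ (deg i + deg j) ((osAdjoint (u i m)).appendTensor (u j m))
      0 ≤ zm.re ∧ zm.im = 0 := by
    intro m
    have hprops := fun j => cutoff_props_pos (hF j) (hu_supp j m)
    exact rp_nonneg_of_compactTime_pos r hK hβ hL ha ha0 haL S₁ hlim hdef (fun j => u j m) (fun j => (hprops j).1)
      (fun j => hu_off j m) (T := 2 * ((m : ℝ) + 1)) (fun j x hx => (hprops j).2 x hx) _
      (fun i j x => SchwartzMap.appendTensor_apply _ _ x)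
  -- and converge to the OS form of `F`
  have hHeq : ∀ i j, H i j = (osAdjoint (F i)).appendTensor (F j) := fun i j => by
    ext x; rw [hH i j x, SchwartzMap.appendTensor_apply]
  have hconv : Tendsto (fun m => ∑ i, ∑ j, S₁ (deg i + deg j) ((osAdjoint (u i m)).appendTensor (u j m))) atTop
      (𝓝 (∑ i, ∑ j, S₁ (deg i + deg j) (H i j))) := by
    refine tendsto_finsetSum _ fun i _ => tendsto_finsetSum _ fun j _ => ?_
    rw [hHeq i j]
    exact ((S₁ (deg i + deg j)).continuous.tendsto _).comp
      (SchwartzMap.tendsto_appendTensor ((continuous_osAdjoint.tendsto _).comp (hu_lim i)) (hu_lim j))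
  have hre := (Complex.continuous_re.tendsto _).comp hconv
  have him := (Complex.continuous_im.tendsto _).comp hconv
  exact ⟨ge_of_tendsto' hre fun m => (hstep m).1,
    tendsto_nhds_unique him (tendsto_const_nhds.congr fun m => ((hstep m).2).symm)⟩

/-! ### Reading the hypotheses off a soft bundle -/

omit [TopologicalSpace G] [IsTopologicalGroup G] [CompactSpace G] [BorelSpace G] in
/-- Along a soft bundle the lattice spacings are positive, tend to zero, and the physical torus sides diverge. -/
theorem softBundle_units {a : ℝ → ℝ} (hapos : ∀ β, 0 < a β) (ha0 : Tendsto a atTop (𝓝 0))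
    {sch : SpeciesScheme (YMSpecies G)} (hunits : ∀ k, sch.a k = a (sch.β k)) (hβ : Tendsto sch.β atTop atTop)
    (hrange : ∀ k, 0 ≤ sch.β k ∧ sch.a k ≤ 1 / 24 ∧ 14 ≤ sch.L k ∧ (sch.a k)⁻¹ * (sch.a k)⁻¹ ≤ sch.L k) :
    (∀ k, 0 < sch.a k) ∧ Tendsto sch.a atTop (𝓝 0) ∧ Tendsto (fun k => sch.a k * sch.L k) atTop atTop := by
  have hpos : ∀ k, 0 < sch.a k := fun k => by rw [hunits k]; exact hapos _
  have ha : Tendsto sch.a atTop (𝓝 0) := by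
    have : sch.a = a ∘ sch.β := funext fun k => hunits k
    rw [this]
    exact ha0.comp hβ
  refine ⟨hpos, ha, ?_⟩
  have hinv : Tendsto (fun k => (sch.a k)⁻¹) atTop atTop :=
    tendsto_inv_nhdsGT_zero.comp (tendsto_nhdsWithin_iff.2 ⟨ha, Eventually.of_forall fun k => hpos k⟩)
  refine tendsto_atTop_mono (fun k => ?_) hinv
  have h := (hrange k).2.2.2
  have hak := hpos k
  calc (sch.a k)⁻¹ = sch.a k * ((sch.a k)⁻¹ * (sch.a k)⁻¹) := by field_simp
    _ ≤ sch.a k * sch.L k := mul_le_mul_of_nonneg_left h hak.le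

/-- Along a soft bundle the centred density distributions converge on `⁰𝒮` in EVERY arity (arities `0, 1` by the
normalisation clauses). -/
theorem softBundle_hlim (r : LatticeRep G) {sch : SpeciesScheme (YMSpecies G)} {S₁ : SchwingerFamily (EuclideanSpace ℝ (Fin 4))}
    (hS₁0 : ∀ F : 𝓢((Fin 0 → (EuclideanSpace ℝ (Fin 4))), ℂ), S₁ 0 F = F default) (hS₁1 : ∀ F : 𝓢((Fin 1 → (EuclideanSpace ℝ (Fin 4))), ℂ), S₁ 1 F = 0)
    (hconv : ∀ n : ℕ, 2 ≤ n → ∀ F : 𝓢((Fin n → (EuclideanSpace ℝ (Fin 4))), ℂ), IsOffDiagonal F →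
      Tendsto (fun k => latticeDist r.ρ (sch.β k) (sch.L k) (sch.a k) r.curvature.F
        (wilsonTorusMean r.ρ (sch.β k) (sch.L k) r.curvature.F) n F) atTop (𝓝 (S₁ n F))) :
    ∀ (m : ℕ) (F : 𝓢((Fin m → (EuclideanSpace ℝ (Fin 4))), ℂ)), (2 ≤ m → IsOffDiagonal F) →
      Tendsto (fun k => latticeDist r.ρ (sch.β k) (sch.L k) (sch.a k) r.curvature.F
        (wilsonTorusMean r.ρ (sch.β k) (sch.L k) r.curvature.F) m F) atTop (𝓝 (S₁ m F)) := by
  intro m F hF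
  rcases Nat.lt_or_ge m 2 with hm | hm
  · interval_cases m
    · simp_rw [latticeDist_zero_apply r.ρ r.continuous, hS₁0]
      exact tendsto_const_nhds
    · simp_rw [latticeDist_one_apply, hS₁1]
      exact tendsto_const_nhds
  · exact hconv m hm F (hF hm)

/-- **`RPPos` along a soft bundle** (any demands `b₀`, `g`). -/
theorem rpPos_of_softBundle' {r : LatticeRep G} {a : ℝ → ℝ} (hapos : ∀ β, 0 < a β) (ha0 : Tendsto a atTop (𝓝 0))
    {sch : SpeciesScheme (YMSpecies G)} {S₁ : SchwingerFamily (EuclideanSpace ℝ (Fin 4))}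
    {Tq : (n : ℕ) → (Fin n → Fin 4 × Fin 4) → (𝓢((Fin n → (EuclideanSpace ℝ (Fin 4))), ℂ) →L[ℂ] ℂ)} {K : ℝ} {b₀ : ℝ} {g : ℝ → ℕ → ℕ}
    (hB : SoftBundle G r a sch S₁ Tq K b₀ g) : RPPos S₁ := by
  obtain ⟨⟨hunits, -, -, hβtop, -, -, -, -, hS₁0, hS₁1, hconv, ⟨hK, -⟩, -, -, -, -, hrange, -, Hdef, -, -⟩, -⟩ := hB
  obtain ⟨hpos, ha, haL⟩ := softBundle_units hapos ha0 hunits hβtop hrange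
  exact rpPos_of_softLimit r hK (fun k => (hrange k).1) (fun k => le_trans (by norm_num) (hrange k).2.2.1) hpos ha haL
    S₁ (softBundle_hlim r hS₁0 hS₁1 hconv) (fun k m hm rr hrr F hF c hc => Hdef k m hm rr hrr F hF c hc)

/-- **`RPPos` along a soft bundle** (registered form; any demands `b₀`, `g`). -/
theorem rpPos_of_softBundle : ∀ {G : Type} [Group G] [TopologicalSpace G] [IsTopologicalGroup G] [CompactSpace G] [MeasurableSpace G] [BorelSpace G] {r : LatticeRep G} {a : ℝ → ℝ}, (∀ β, 0 < a β) → Filter.Tendsto a Filter.atTop (nhds 0) → ∀ {sch : SpeciesScheme (YMSpecies G)} {S₁ : SchwingerFamily (EuclideanSpace ℝ (Fin 4))} {Tq : (n : ℕ) → (Fin n → Fin 4 × Fin 4) → (SchwartzMap (Fin n → EuclideanSpace ℝ (Fin 4)) ℂ →L[ℂ] ℂ)} {K : ℝ} {b₀ : ℝ} {g : ℝ → ℕ → ℕ}, Summit.QuantumFields.YangMills.Cruxes.OSLegsFromFemtoAndGap.DlrCollarTransfer.SoftBundle G r a sch S₁ Tq K b₀ g → Summit.QuantumFields.YangMills.Cruxes.OSLegsFromFemtoAndGap.DlrCollarTransfer.RPPos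 S₁ :=
  fun hapos ha0 _ _ _ _ _ _ hB => rpPos_of_softBundle' hapos ha0 hB

end Summit.QuantumFields.YangMills.Theorems.OSLegsFromFemtoAndGap

end
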